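import Literature.MathematicalPhysics.QuantumManyBody.BoseEinsteinCondensation
import Mathlib.Analysis.Calculus.FDeriv.Measurable
import Mathlib.Analysis.InnerProductSpace.Basic
import Mathlib.Algebra.Order.Chebyshev
import HarnessLib

/-!
# Centre-of-mass / relative splitting of the kinetic energy of the Bose gas in a box

Topic `Literature/MathematicalPhysics/QuantumManyBody` (vocabulary of `BoseEinsteinCondensation.lean`:
`Config`, `TrialState`, `kineticDensity`, `interaction`, `energy`, `groundStateEnergy`).

For `N` particles of mass `m = ½` (units `ħ = 2m = 1`) the kinetic energy splits into the kinetic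
energy of the centre of mass and that of the relative motion (König's theorem / Lagrange's identity):
`∑ⱼ pⱼ² = P²/N + (2N)⁻¹ ∑_{j,k} (pⱼ - p_k)²`, `P = ∑ⱼ pⱼ`, i.e. `H = P²/(2mN) + H_rel`
[cite: CorneanDerezinskiZin2009, §2.2 (2.3)]. Pointwise, for a wave function `ψ` on `(ℝ³)^N`,

  `N |∇ψ(X)|² = ∑ₐ |∑ⱼ ∂_{j,a}ψ(X)|² + ½ ∑ₐ ∑_{j,k} |∂_{j,a}ψ(X) - ∂_{k,a}ψ(X)|²`,

where `∑ⱼ ∂_{j,a}ψ = fderiv ψ X (eₐ, …, eₐ)` is the derivative along the rigid translation of all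
particles in the coordinate direction `a` (the total momentum `Pₐψ`, up to `-i`).

* `comKineticDensity ψ X = N⁻¹ ∑ₐ |∑ⱼ ∂_{j,a}ψ(X)|²` — kinetic energy density of the centre of mass
  (`|Pψ|²/N`);
* `relKineticDensity ψ X = (2N)⁻¹ ∑ₐ ∑_{j,k} |(∂_{j,a} - ∂_{k,a})ψ(X)|²` — kinetic energy density of
  the relative motion (derivatives along the relative coordinates only);
* `kineticDensity_eq_com_add_rel` — the pointwise splitting `|∇ψ|² = comKineticDensity + relKineticDensity`
  (all `N`, in `ℝ≥0∞`, no side conditions);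
* `relEnergy v Ψ = ∫ (relKineticDensity + ∑_{i<j} v |Ψ|²)`, the quadratic form of
  `H_rel = H - P²/N` (no kinetic energy along the three rigid translations), and
  `relGroundStateEnergy v N L = inf_Ψ relEnergy v Ψ` over the same Dirichlet trial states;
* `energy_eq_lintegral_com_add_relEnergy` : `⟨Ψ,HΨ⟩ = ∫ comKineticDensity + ⟨Ψ,H_rel Ψ⟩`, hence
  `sum_lintegral_rigid_sq_add` : `∑ₐ ∫|∑ⱼ∂_{j,a}Ψ|² + N·relEnergy = N·energy` — the total-momentum
  fluctuation `⟨Ψ,P²Ψ⟩` of a state is `N` times the amount by which its energy exceeds its relative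
  energy — and the variational consequences `relEnergy ≤ energy`,
  `relGroundStateEnergy ≤ groundStateEnergy`, `∑ₐ ∫|∑ⱼ∂_{j,a}Ψ|² ≤ N ∫ |∇Ψ|²` (Cauchy–Schwarz).

Deliberately NOT here: the fibre decomposition of `H_rel` over the centre-of-mass coordinate, any
statement about ground states, Galilei boosts (`PeriodicTrialState.boost` lives in
`Literature/Barriers/AtomisticToContinuum/KineticGapLengthScalesNarrow.lean`), the periodic versions
(`PeriodicBoseGasMomentumSector.lean` has `P Ψ = k Ψ` sectors and `H ≥ |k|²/M`).

## References

* [CorneanDerezinskiZin2009] H. D. Cornean, J. Dereziński, P. Ziń, *On the infimum of the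
  energy–momentum spectrum of a homogeneous Bose gas*, J. Math. Phys. 50 (2009) 062103, §2.2 (2.3)
  (`H = P²/2nm + H_rel`, Galilei-invariant splitting).
* Lagrange's identity `N ∑|gⱼ|² = |∑gⱼ|² + ½∑_{j,k}|gⱼ - g_k|²` (König's theorem) is folklore.
-/

noncomputable section

open MeasureTheory Filter
open scoped ENNReal NNReal

namespace Literature.MathematicalPhysics.QuantumManyBody.BoseGas

variable {N : ℕ}

/-! ### Lagrange's identity -/

/-- **Lagrange's identity** in a real inner product space: for `g : Fin N → E`,
`N ∑ⱼ ‖gⱼ‖² = ‖∑ⱼ gⱼ‖² + ½ ∑ⱼ ∑ₖ ‖gⱼ - gₖ‖²` (König's decomposition of the kinetic energy into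
centre-of-mass and relative parts, for unit masses). [folklore] -/
theorem lagrange_identity {E : Type*} [NormedAddCommGroup E] [InnerProductSpace ℝ E]
    (g : Fin N → E) :
    (N : ℝ) * ∑ j, ‖g j‖ ^ 2 = ‖∑ j, g j‖ ^ 2 + 2⁻¹ * ∑ j, ∑ k, ‖g j - g k‖ ^ 2 := by
  have h1 : ‖∑ j, g j‖ ^ 2 = ∑ j, ∑ k, inner ℝ (g j) (g k) := by
    rw [← real_inner_self_eq_norm_sq, sum_inner]
    exact Finset.sum_congr rfl fun j _ => inner_sum _ _ _
  have h2 : ∑ j, ∑ k, ‖g j - g k‖ ^ 2 =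
      ∑ j, ∑ k, (‖g j‖ ^ 2 + ‖g k‖ ^ 2) - 2 * ∑ j, ∑ k, inner ℝ (g j) (g k) := by
    rw [Finset.mul_sum, ← Finset.sum_sub_distrib]
    refine Finset.sum_congr rfl fun j _ => ?_
    rw [Finset.mul_sum, ← Finset.sum_sub_distrib]
    refine Finset.sum_congr rfl fun k _ => ?_
    rw [norm_sub_sq_real]
    ring
  have h3 : ∑ j, ∑ k, (‖g j‖ ^ 2 + ‖g k‖ ^ 2) = 2 * ((N : ℝ) * ∑ j, ‖g j‖ ^ 2) := by
    simp only [Finset.sum_add_distrib, Finset.sum_const, Finset.card_univ, Fintype.card_fin,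
      nsmul_eq_mul]
    rw [← Finset.mul_sum]
    ring
  rw [h2, h3, h1]
  ring

/-- `(‖z‖₊)² = ofReal (‖z‖²)` in `ℝ≥0∞` (local copy of the bookkeeping lemma of
`PeriodicBoseGasFourier.lean`, to keep the imports of this file minimal). [folklore] -/
private theorem coe_nnnorm_sq_eq_ofReal_koenig {E : Type*} [SeminormedAddCommGroup E] (z : E) :
    ((‖z‖₊ : ℝ≥0∞) ^ 2) = ENNReal.ofReal (‖z‖ ^ 2) := by
  rw [ENNReal.ofReal_pow (norm_nonneg _), ofReal_norm, enorm_eq_nnnorm]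

/-! ### The centre-of-mass and relative kinetic energy densities -/

/-- The **centre-of-mass kinetic energy density** `|PΨ(X)|²/N = N⁻¹ ∑ₐ |∑ⱼ ∂_{j,a}ψ(X)|²`, where
`∑ⱼ ∂_{j,a}ψ(X) = fderiv ψ X (eₐ,…,eₐ)` is the derivative along the rigid translation of all
particles in direction `a` (units `ħ = 2m = 1`, total mass `N m`). Junk value `0` for `N = 0`.
[cite: CorneanDerezinskiZin2009, §2.2 (2.3)] -/
def comKineticDensity (ψ : Config N → ℂ) (X : Config N) : ℝ≥0∞ :=
  (N : ℝ≥0∞)⁻¹ *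
    ∑ a : Fin 3, (‖fderiv ℝ ψ X (fun _ : Fin N => EuclideanSpace.single a (1 : ℝ))‖₊ : ℝ≥0∞) ^ 2

/-- The **relative kinetic energy density** `(2N)⁻¹ ∑ₐ ∑ⱼ ∑ₖ |∂_{j,a}ψ(X) - ∂_{k,a}ψ(X)|²`: the
kinetic energy of the motion relative to the centre of mass, i.e. the sum of the squared derivatives
along the relative coordinates `xⱼ - xₖ` with König's weight `1/(2N)`. Junk value `0` for `N = 0`.
[cite: CorneanDerezinskiZin2009, §2.2 (2.3)] -/
def relKineticDensity (ψ : Config N → ℂ) (X : Config N) : ℝ≥0∞ :=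
  (2 * N : ℝ≥0∞)⁻¹ * ∑ a : Fin 3, ∑ j : Fin N, ∑ k : Fin N,
    (‖fderiv ℝ ψ X (Pi.single j (EuclideanSpace.single a (1 : ℝ)) -
        Pi.single k (EuclideanSpace.single a (1 : ℝ)))‖₊ : ℝ≥0∞) ^ 2

/-- The rigid-translation derivative is the sum of the one-particle derivatives:
`fderiv ψ X (eₐ,…,eₐ) = ∑ⱼ ∂_{j,a}ψ(X)` (linearity of the Fréchet derivative). [folklore] -/
theorem fderiv_rigid_eq_sum (ψ : Config N → ℂ) (X : Config N) (a : Fin 3) :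
    fderiv ℝ ψ X (fun _ : Fin N => EuclideanSpace.single a (1 : ℝ)) =
      ∑ j, fderiv ℝ ψ X (Pi.single j (EuclideanSpace.single a (1 : ℝ))) := by
  rw [← map_sum]
  congr 1
  exact (Finset.univ_sum_single fun _ : Fin N => EuclideanSpace.single a (1 : ℝ)).symm

/-- **König / Lagrange splitting in one coordinate direction**, pointwise in `ℝ≥0∞`:
`N ∑ⱼ |∂_{j,a}ψ|² = |∑ⱼ ∂_{j,a}ψ|² + ½ ∑ⱼ ∑ₖ |∂_{j,a}ψ - ∂_{k,a}ψ|²`.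
[cite: CorneanDerezinskiZin2009, §2.2 (2.3)] -/
theorem natCast_mul_sum_sq_fderiv_single (ψ : Config N → ℂ) (X : Config N) (a : Fin 3) :
    (N : ℝ≥0∞) * ∑ j, (‖fderiv ℝ ψ X (Pi.single j (EuclideanSpace.single a (1 : ℝ)))‖₊ : ℝ≥0∞) ^ 2 =
      (‖fderiv ℝ ψ X (fun _ : Fin N => EuclideanSpace.single a (1 : ℝ))‖₊ : ℝ≥0∞) ^ 2 +
        2⁻¹ * ∑ j : Fin N, ∑ k : Fin N, (‖fderiv ℝ ψ X (Pi.single j (EuclideanSpace.single a (1 : ℝ)) -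
          Pi.single k (EuclideanSpace.single a (1 : ℝ)))‖₊ : ℝ≥0∞) ^ 2 := by
  set g : Fin N → ℂ := fun j => fderiv ℝ ψ X (Pi.single j (EuclideanSpace.single a (1 : ℝ))) with hg
  have hrig : fderiv ℝ ψ X (fun _ : Fin N => EuclideanSpace.single a (1 : ℝ)) = ∑ j, g j :=
    fderiv_rigid_eq_sum ψ X a
  have hdiff : ∀ j k : Fin N, fderiv ℝ ψ X (Pi.single j (EuclideanSpace.single a (1 : ℝ)) -
      Pi.single k (EuclideanSpace.single a (1 : ℝ))) = g j - g k := fun j k => by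
    rw [map_sub]
  simp only [hdiff, hrig]
  have hreal := lagrange_identity (E := ℂ) g
  have h2 : (2⁻¹ : ℝ≥0∞) = ENNReal.ofReal 2⁻¹ := by
    rw [ENNReal.ofReal_inv_of_pos two_pos, ENNReal.ofReal_ofNat]
  simp only [coe_nnnorm_sq_eq_ofReal_koenig] at *
  rw [← ENNReal.ofReal_sum_of_nonneg fun j _ => sq_nonneg _, ← ENNReal.ofReal_natCast,
    ← ENNReal.ofReal_mul (Nat.cast_nonneg _), hreal, ENNReal.ofReal_add (sq_nonneg _)
      (mul_nonneg (by norm_num) (Finset.sum_nonneg fun j _ => Finset.sum_nonneg fun k _ =>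
        sq_nonneg _)), ENNReal.ofReal_mul (by norm_num), h2,
    ENNReal.ofReal_sum_of_nonneg fun j _ => Finset.sum_nonneg fun k _ => sq_nonneg _]
  congr 2
  exact Finset.sum_congr rfl fun j _ => ENNReal.ofReal_sum_of_nonneg fun k _ => sq_nonneg _

/-- `N |∇ψ|² = ∑ₐ |∑ⱼ∂_{j,a}ψ|² + ½ ∑ₐ∑ⱼ∑ₖ |∂_{j,a}ψ - ∂_{k,a}ψ|²` (the three coordinate directions
summed). [cite: CorneanDerezinskiZin2009, §2.2 (2.3)] -/
theorem natCast_mul_kineticDensity (ψ : Config N → ℂ) (X : Config N) :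
    (N : ℝ≥0∞) * kineticDensity ψ X =
      (∑ a : Fin 3, (‖fderiv ℝ ψ X (fun _ : Fin N => EuclideanSpace.single a (1 : ℝ))‖₊ : ℝ≥0∞) ^ 2) +
        2⁻¹ * ∑ a : Fin 3, ∑ j : Fin N, ∑ k : Fin N,
          (‖fderiv ℝ ψ X (Pi.single j (EuclideanSpace.single a (1 : ℝ)) -
            Pi.single k (EuclideanSpace.single a (1 : ℝ)))‖₊ : ℝ≥0∞) ^ 2 := by
  unfold kineticDensity
  rw [Finset.sum_comm, Finset.mul_sum]
  simp_rw [natCast_mul_sum_sq_fderiv_single]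
  rw [Finset.sum_add_distrib, ← Finset.mul_sum]

/-- **König's theorem, pointwise**: `|∇ψ(X)|² = comKineticDensity ψ X + relKineticDensity ψ X` for
every `ψ`, `X` and every `N` (for `N = 0` all three vanish). [cite: CorneanDerezinskiZin2009, §2.2 (2.3)] -/
theorem kineticDensity_eq_com_add_rel (ψ : Config N → ℂ) (X : Config N) :
    kineticDensity ψ X = comKineticDensity ψ X + relKineticDensity ψ X := by
  rcases Nat.eq_zero_or_pos N with hN | hN
  · subst hN
    have h0 : ∀ y : Config 0, fderiv ℝ ψ X y = 0 := fun y => by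
      rw [Subsingleton.elim y 0, map_zero]
    simp [kineticDensity, comKineticDensity, relKineticDensity, h0]
  · have hN0 : (N : ℝ≥0∞) ≠ 0 := by exact_mod_cast hN.ne'
    have hNtop : (N : ℝ≥0∞) ≠ ⊤ := ENNReal.natCast_ne_top N
    calc kineticDensity ψ X = (N : ℝ≥0∞)⁻¹ * ((N : ℝ≥0∞) * kineticDensity ψ X) := by
          rw [← mul_assoc, ENNReal.inv_mul_cancel hN0 hNtop, one_mul]
      _ = comKineticDensity ψ X + relKineticDensity ψ X := by
          rw [natCast_mul_kineticDensity, mul_add, comKineticDensity, relKineticDensity,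
            ENNReal.mul_inv (Or.inl two_ne_zero) (Or.inl (by norm_num)), ← mul_assoc,
            mul_comm ((N : ℝ≥0∞)⁻¹) 2⁻¹]

/-- The centre-of-mass kinetic density is dominated by the kinetic density
(`|∑ⱼ∂_{j,a}ψ|² ≤ N ∑ⱼ|∂_{j,a}ψ|²`, Cauchy–Schwarz). [folklore] -/
theorem comKineticDensity_le_kineticDensity (ψ : Config N → ℂ) (X : Config N) :
    comKineticDensity ψ X ≤ kineticDensity ψ X := by
  rw [kineticDensity_eq_com_add_rel]
  exact le_self_add

/-- The relative kinetic density is dominated by the kinetic density. [folklore] -/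
theorem relKineticDensity_le_kineticDensity (ψ : Config N → ℂ) (X : Config N) :
    relKineticDensity ψ X ≤ kineticDensity ψ X := by
  rw [kineticDensity_eq_com_add_rel]
  exact le_add_self

/-- **A-priori bound on the total-momentum density**: `∑ₐ |∑ⱼ ∂_{j,a}ψ(X)|² ≤ N |∇ψ(X)|²`
(Cauchy–Schwarz; the relative part dropped). [folklore] -/
theorem sum_sq_fderiv_rigid_le (ψ : Config N → ℂ) (X : Config N) :
    ∑ a : Fin 3, (‖fderiv ℝ ψ X (fun _ : Fin N => EuclideanSpace.single a (1 : ℝ))‖₊ : ℝ≥0∞) ^ 2 ≤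
      (N : ℝ≥0∞) * kineticDensity ψ X := by
  rw [natCast_mul_kineticDensity]
  exact le_self_add

/-- Measurability of the centre-of-mass kinetic density (`fderiv` is measurable). [folklore] -/
theorem measurable_comKineticDensity (ψ : Config N → ℂ) : Measurable (comKineticDensity ψ) := by
  refine Measurable.const_mul (Finset.measurable_sum _ fun a _ => ?_) _
  exact ((measurable_fderiv_apply_const ℝ ψ _).nnnorm.coe_nnreal_ennreal).pow_const 2

/-- Measurability of the relative kinetic density (`fderiv` is measurable). [folklore] -/
theorem measurable_relKineticDensity (ψ : Config N → ℂ) : Measurable (relKineticDensity ψ) := by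
  refine Measurable.const_mul (Finset.measurable_sum _ fun a _ => Finset.measurable_sum _ fun j _ =>
    Finset.measurable_sum _ fun k _ => ?_) _
  exact ((measurable_fderiv_apply_const ℝ ψ _).nnnorm.coe_nnreal_ennreal).pow_const 2

/-! ### The relative energy and its infimum -/

/-- The **relative energy** `⟨Ψ, H_rel Ψ⟩ = ∫ ((2N)⁻¹∑ₐ∑_{j,k}|(∂_{j,a}-∂_{k,a})Ψ|² + ∑_{i<j} v(|xᵢ-xⱼ|)|Ψ|²)`
of a Dirichlet trial state: the quadratic form of `H_rel = H - P²/N = ∑ⱼ(pⱼ - P/N)² + V`, the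
Hamiltonian with the kinetic energy of the centre of mass removed (no kinetic term along the three
rigid translations; the pair interaction is unchanged). [cite: CorneanDerezinskiZin2009, §2.2 (2.3)] -/
def relEnergy {L : ℝ} (v : ℝ → ℝ≥0∞) (Ψ : TrialState N L) : ℝ≥0∞ :=
  ∫⁻ X, relKineticDensity Ψ.ψ X + interaction v X * (‖Ψ.ψ X‖₊ : ℝ≥0∞) ^ 2

/-- The **infimum of the relative energy** `inf_Ψ ⟨Ψ, H_rel Ψ⟩` over the admissible Dirichlet trial
states of `N` bosons in the box `Λ_L` (the bottom of the form of `H - P²/N` on the Dirichlet form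
core; `⊤` if there are no trial states). [cite: CorneanDerezinskiZin2009, §2.2 (2.3)] -/
def relGroundStateEnergy (v : ℝ → ℝ≥0∞) (N : ℕ) (L : ℝ) : ℝ≥0∞ :=
  ⨅ Ψ : TrialState N L, relEnergy v Ψ

/-- Variational principle for the relative energy (definition of the infimum). [folklore] -/
theorem relGroundStateEnergy_le_relEnergy {L : ℝ} (v : ℝ → ℝ≥0∞) (Ψ : TrialState N L) :
    relGroundStateEnergy v N L ≤ relEnergy v Ψ :=
  iInf_le _ Ψ

/-- **`⟨Ψ,HΨ⟩ = ∫ |PΨ|²/N + ⟨Ψ,H_rel Ψ⟩`**: the energy is the centre-of-mass kinetic energy plus the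
relative energy. [cite: CorneanDerezinskiZin2009, §2.2 (2.3)] -/
theorem energy_eq_lintegral_com_add_relEnergy {L : ℝ} (v : ℝ → ℝ≥0∞) (Ψ : TrialState N L) :
    energy v Ψ = (∫⁻ X, comKineticDensity Ψ.ψ X) + relEnergy v Ψ := by
  rw [energy, relEnergy, ← lintegral_add_left (measurable_comKineticDensity Ψ.ψ)]
  refine lintegral_congr fun X => ?_
  rw [kineticDensity_eq_com_add_rel, add_assoc]

/-- The relative energy is at most the energy (`H_rel ≤ H`). [folklore] -/
theorem relEnergy_le_energy {L : ℝ} (v : ℝ → ℝ≥0∞) (Ψ : TrialState N L) :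
    relEnergy v Ψ ≤ energy v Ψ := by
  rw [energy_eq_lintegral_com_add_relEnergy]
  exact le_add_self

/-- `inf H_rel ≤ inf H` on the same trial states. [folklore] -/
theorem relGroundStateEnergy_le_groundStateEnergy (v : ℝ → ℝ≥0∞) (N : ℕ) (L : ℝ) :
    relGroundStateEnergy v N L ≤ groundStateEnergy v N L :=
  iInf_mono fun Ψ => relEnergy_le_energy v Ψ

/-- The total-momentum fluctuation `⟨Ψ, P²Ψ⟩ = ∑ₐ ∫ |∑ⱼ ∂_{j,a}Ψ|²` is `N` times the centre-of-mass
kinetic energy `∫ |PΨ|²/N`. [folklore] -/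
theorem sum_lintegral_sq_fderiv_rigid_eq {L : ℝ} (Ψ : TrialState N L) :
    ∑ a : Fin 3, ∫⁻ X, (‖fderiv ℝ Ψ.ψ X (fun _ : Fin N => EuclideanSpace.single a (1 : ℝ))‖₊ : ℝ≥0∞) ^ 2 =
      (N : ℝ≥0∞) * ∫⁻ X, comKineticDensity Ψ.ψ X := by
  rcases Nat.eq_zero_or_pos N with hN | hN
  · subst hN
    have h0 : ∀ (X : Config 0) (y : Config 0), fderiv ℝ Ψ.ψ X y = 0 := fun X y => by
      rw [Subsingleton.elim y 0, map_zero]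
    simp [h0]
  · have hN0 : (N : ℝ≥0∞) ≠ 0 := by exact_mod_cast hN.ne'
    have hNtop : (N : ℝ≥0∞) ≠ ⊤ := ENNReal.natCast_ne_top N
    have hmeas : ∀ a : Fin 3, Measurable fun X =>
        (‖fderiv ℝ Ψ.ψ X (fun _ : Fin N => EuclideanSpace.single a (1 : ℝ))‖₊ : ℝ≥0∞) ^ 2 :=
      fun a => ((measurable_fderiv_apply_const ℝ Ψ.ψ _).nnnorm.coe_nnreal_ennreal).pow_const 2
    rw [← lintegral_finsetSum _ fun a _ => hmeas a]
    simp only [comKineticDensity]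
    rw [lintegral_const_mul _ (Finset.measurable_sum _ fun a _ => hmeas a), ← mul_assoc,
      ENNReal.mul_inv_cancel hN0 hNtop, one_mul]

/-- **`⟨Ψ,P²Ψ⟩ + N ⟨Ψ,H_rel Ψ⟩ = N ⟨Ψ,HΨ⟩`** (junk-free `ℝ≥0∞` form of `P²/N = H - H_rel` in the
state `Ψ`): the total-momentum fluctuation of a state is `N` times the excess of its energy over its
relative energy. [cite: CorneanDerezinskiZin2009, §2.2 (2.3)] -/
theorem sum_lintegral_sq_fderiv_rigid_add {L : ℝ} (v : ℝ → ℝ≥0∞) (Ψ : TrialState N L) :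
    (∑ a : Fin 3, ∫⁻ X, (‖fderiv ℝ Ψ.ψ X (fun _ : Fin N => EuclideanSpace.single a (1 : ℝ))‖₊ : ℝ≥0∞) ^ 2) +
        (N : ℝ≥0∞) * relEnergy v Ψ = (N : ℝ≥0∞) * energy v Ψ := by
  rw [sum_lintegral_sq_fderiv_rigid_eq, energy_eq_lintegral_com_add_relEnergy, mul_add]

/-- **A-priori bound** `⟨Ψ,P²Ψ⟩ ≤ N ∫|∇Ψ|² ≤ N ⟨Ψ,HΨ⟩` (Cauchy–Schwarz). [folklore] -/
theorem sum_lintegral_sq_fderiv_rigid_le {L : ℝ} (v : ℝ → ℝ≥0∞) (Ψ : TrialState N L) :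
    ∑ a : Fin 3, ∫⁻ X, (‖fderiv ℝ Ψ.ψ X (fun _ : Fin N => EuclideanSpace.single a (1 : ℝ))‖₊ : ℝ≥0∞) ^ 2 ≤
      (N : ℝ≥0∞) * energy v Ψ := by
  rw [← sum_lintegral_sq_fderiv_rigid_add v Ψ]
  exact le_self_add

/-- **Reduction of a total-momentum bound to an energy comparison.** If `Ψ` has finite energy and
its energy exceeds the infimum of the relative energy by at most `η` (`⟨Ψ,HΨ⟩ ≤ inf H_rel + η`), then
`⟨Ψ,P²Ψ⟩ ≤ N η`: indeed `⟨Ψ,P²Ψ⟩ + N⟨Ψ,H_relΨ⟩ = N⟨Ψ,HΨ⟩ ≤ N inf H_rel + Nη ≤ N⟨Ψ,H_relΨ⟩ + Nη`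
and the finite term `N⟨Ψ,H_relΨ⟩` cancels. (Without `⟨Ψ,HΨ⟩ < ∞` the hypothesis is vacuous when
`inf H_rel = ∞` and the conclusion can fail.) [folklore] -/
theorem sum_lintegral_sq_fderiv_rigid_le_of_energy_le {L : ℝ} (v : ℝ → ℝ≥0∞) (Ψ : TrialState N L)
    (hE : energy v Ψ ≠ ⊤) {η : ℝ≥0∞} (h : energy v Ψ ≤ relGroundStateEnergy v N L + η) :
    ∑ a : Fin 3, ∫⁻ X, (‖fderiv ℝ Ψ.ψ X (fun _ : Fin N => EuclideanSpace.single a (1 : ℝ))‖₊ : ℝ≥0∞) ^ 2 ≤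
      (N : ℝ≥0∞) * η := by
  have hfin : (N : ℝ≥0∞) * relEnergy v Ψ ≠ ⊤ :=
    ENNReal.mul_ne_top (ENNReal.natCast_ne_top N) (ne_top_of_le_ne_top hE (relEnergy_le_energy v Ψ))
  refine (ENNReal.add_le_add_iff_right hfin).1 ?_
  calc (∑ a : Fin 3, ∫⁻ X,
          (‖fderiv ℝ Ψ.ψ X (fun _ : Fin N => EuclideanSpace.single a (1 : ℝ))‖₊ : ℝ≥0∞) ^ 2) +
          (N : ℝ≥0∞) * relEnergy v Ψ
        = (N : ℝ≥0∞) * energy v Ψ := sum_lintegral_sq_fderiv_rigid_add v Ψ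
    _ ≤ (N : ℝ≥0∞) * (relGroundStateEnergy v N L + η) := by gcongr
    _ ≤ (N : ℝ≥0∞) * (relEnergy v Ψ + η) := by
        gcongr
        exact relGroundStateEnergy_le_relEnergy v Ψ
    _ = (N : ℝ≥0∞) * η + (N : ℝ≥0∞) * relEnergy v Ψ := by rw [mul_add, add_comm]

end Literature.MathematicalPhysics.QuantumManyBody.BoseGas

end
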